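import Literature.AlgebraicGeometry.Frobenioids.GroupSubfunctors
import Literature.AlgebraicGeometry.Frobenioids.MonoidFunctors
import Mathlib.Data.Real.Basic
import HarnessLib

/-!
# Frobenioids I, §5: `ℚ · Ψ = Ψ^pf` and `ℝ · Ψ` for a subfunctor of groups `Ψ ⊆ Φ^gp`; the perfected
# and realified model Frobenioids (the constructions behind Prop. 5.3 and Prop. 5.5 (iv))

Mochizuki, *The geometry of Frobenioids I: the general theory*, Kyushu J. Math. **62** (2008)
293–400, §5, Proposition 5.3 p. 103 and Proposition 5.5 (iv) p. 104; §2, Definition 2.4 (i)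
pp. 47–48 [cite: MochizukiFrdI2008, Prop. 5.3 p.103] [cite: MochizukiFrdI2008, Prop. 5.5 (iv) p.104].

**Text (p. 103).** "Suppose that `Φ` is perf-factorial. Then we shall refer to as the realification
`C^rlf` of the Frobenioid `C` the model Frobenioid associated to the divisor monoid `Φ^rlf` [i.e., the
'realification' of Definition 2.4, (i)] and the rational function monoid `ℝ · Φ^birat ⊆ (Φ^rlf)^gp`
[i.e., for `A_D ∈ Ob(D)`, `(ℝ · Φ^birat)(A_D)` is the `ℝ`-vector subspace of `(Φ^rlf)^gp(A_D)`
generated by `Φ^birat(A_D)`]. Moreover, … `(C^un-tr)^pf` … may be obtained as the model Frobenioid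
associated to the divisor monoid … `Φ^pf` and the rational function monoid …
`ℚ · Φ^birat = Φ^birat ⊗_ℤ ℚ = (Φ^birat)^pf`." (p. 104, Prop. 5.5 (iv)): "… the model Frobenioid
associated to the data `Φ^pf, B^pf, B^pf → (Φ^gp)^pf` (respectively, `Φ, Φ^birat, Φ^birat ↪ Φ^gp`;
`Φ^rlf, ℝ · Φ^birat, ℝ · Φ^birat ↪ (Φ^rlf)^gp`)".

**Contents.** For a monoid `Φ` on `D` and a subfunctor of groups `Ψ ⊆ Φ^gp` (`GpSubfunctor`,
file `GroupSubfunctors.lean`; in the text `Ψ = Φ^birat`):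
* `toPfGp Φ X : Φ(X)^gp → (Φ^pf(X))^gp` (groupification of `Φ → Φ^pf`, file `MonoidFunctors.lean`)
  and its naturality; `Ψ.perfection : GpSubfunctor Φ^pf` = `ℚ · Ψ = Ψ^pf` realised inside
  `(Φ^pf)^gp` as the elements with a positive power in the image of `Ψ`; `Ψ.PfModelOf` = "the model
  Frobenioid associated to `Φ^pf` and `Ψ^pf`".
* `RealificationData Φ` — INTERFACE (`TODO-merge: abc-iut-L1-t2`, interface I3 of
  plan/L1/ASSIGNMENTS.md): the realification `Φ^rlf` of Def. 2.4 (i) AS A MONOID ON `D` together with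
  `Φ^pf → Φ^rlf` and the `ℝ`-vector space structure of the `(Φ^rlf)^gp(X)` (Def. 2.4 (i) p. 48:
  "`(M^rlf)^gp ⊆ (M^rlf_factor)^gp = ∏ (M^rlf_𝔭)^gp` is an `ℝ`-vector space"), functorial in `X`.
  The objectwise realification `M^rlf` exists in the tree (`PerfFactorial.lean`, seat abc-iut-L1-t2);
  its functoriality in `D` ("the divisor monoid `Φ^rlf`", p. 103) is not yet declared there, so it is
  recorded here as a structure whose fields quote the text, to be instantiated by that seat's functor.
* `R.realSpan Ψ : GpSubfunctor R.rlf` = `ℝ · Ψ ⊆ (Φ^rlf)^gp` (the subgroup generated by the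
  `r • ι(c)`, i.e. the `ℝ`-subspace generated by the image of `Ψ`); `R.RlfModelOf Ψ` = "the model
  Frobenioid associated to the divisor monoid `Φ^rlf` and the rational function monoid `ℝ · Ψ`" — for
  `Ψ = Φ^birat` this is **the realification `C^rlf`** of Prop. 5.3 (instantiated in
  `FrobenioidRealification.lean`).
Multiplicative rendering (`M^gp = Algebra.GrothendieckGroup M`, `r • x` written `rsmul X r x`).
-/

namespace Literature.AlgebraicGeometry.Frobenioids

open CategoryTheory Opposite

universe w v u

variable {D : Type u} [Category.{v} D]

/-! ### `Φ^gp → (Φ^pf)^gp` and the perfection `ℚ · Ψ = Ψ^pf` of a subfunctor of groups -/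

section Perfection

variable (Φ : Dᵒᵖ ⥤ CommMonCat.{w})

/-- The groupification `Φ(X)^gp → (Φ^pf(X))^gp` of the natural map `Φ(X) → Φ(X)^pf` (§0 p. 11,
Def. 1.1 (ii)): the comparison through which `Φ^birat ⊆ Φ^gp` is viewed inside `(Φ^gp)^pf = (Φ^pf)^gp`
(Prop. 5.3 p. 103, "`ℚ · Φ^birat = Φ^birat ⊗_ℤ ℚ = (Φ^birat)^pf`"). [cite: MochizukiFrdI2008, Prop. 5.3 p.103] -/
noncomputable def toPfGp (X : D) :
    Algebra.GrothendieckGroup (Φ.obj (op X)) →*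
      Algebra.GrothendieckGroup ((perfectionFunctor Φ).obj (op X)) :=
  MonGp.map ((toPerfectionFunctor Φ).app (op X)).hom

/-- Naturality of `Φ^gp → (Φ^pf)^gp` with respect to the pull-back maps `Φ(f)`, `Φ^pf(f)`.
[cite: MochizukiFrdI2008, Def. 1.1 (ii) p.19] -/
theorem toPfGp_pullGp {X Y : D} (f : X ⟶ Y) (c : Algebra.GrothendieckGroup (Φ.obj (op Y))) :
    toPfGp Φ X (pullGp Φ f c) = pullGp (perfectionFunctor Φ) f (toPfGp Φ Y c) := by
  have key : (toPfGp Φ X).comp (pullGp Φ f) =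
      (pullGp (perfectionFunctor Φ) f).comp (toPfGp Φ Y) := by
    apply MonGp.hom_ext
    intro a
    have h := congrArg (fun g => (CommMonCat.Hom.hom g) a) ((toPerfectionFunctor Φ).naturality f.op)
    simp only [MonoidHom.comp_apply, toPfGp, pullGp, MonGp.map_of]
    exact congrArg Algebra.GrothendieckGroup.of h
  exact DFunLike.congr_fun key c

variable {Φ} (Ψ : GpSubfunctor Φ)

namespace GpSubfunctor

/-- `ℚ · Ψ = Ψ ⊗_ℤ ℚ = Ψ^pf ⊆ (Φ^gp)^pf = (Φ^pf)^gp` (Prop. 5.3 p. 103, for `Ψ = Φ^birat`): the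
elements of `(Φ^pf(X))^gp` some positive power of which lies in the image of `Ψ(X)`.
[cite: MochizukiFrdI2008, Prop. 5.3 p.103] -/
noncomputable def perfection : GpSubfunctor (perfectionFunctor Φ) where
  carrier X :=
    { carrier := {x | ∃ n : ℕ+, x ^ (n : ℕ) ∈ (Ψ.carrier X).map (toPfGp Φ X)}
      one_mem' := ⟨1, by rw [PNat.one_coe, pow_one]; exact one_mem _⟩
      mul_mem' := by
        rintro x y ⟨n, hn⟩ ⟨m, hm⟩
        refine ⟨n * m, ?_⟩
        rw [mul_pow, PNat.mul_coe, pow_mul, mul_comm (n : ℕ) (m : ℕ), pow_mul]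
        exact mul_mem (pow_mem hn _) (pow_mem hm _)
      inv_mem' := by
        rintro x ⟨n, hn⟩
        exact ⟨n, by rw [inv_pow]; exact inv_mem hn⟩ }
  pull_mem := by
    rintro X Y f c ⟨n, hn⟩
    refine ⟨n, ?_⟩
    rw [← map_pow]
    obtain ⟨b, hb, hbc⟩ := hn
    refine ⟨pullGp Φ f b, Ψ.pull_mem f hb, ?_⟩
    rw [toPfGp_pullGp, hbc]

/-- Membership in `Ψ^pf(X)`: some positive power lies in the image of `Ψ(X)`.
[cite: MochizukiFrdI2008, Prop. 5.3 p.103] -/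
theorem mem_perfection_iff (X : D) (x : Algebra.GrothendieckGroup ((perfectionFunctor Φ).obj (op X))) :
    x ∈ Ψ.perfection.carrier X ↔ ∃ n : ℕ+, x ^ (n : ℕ) ∈ (Ψ.carrier X).map (toPfGp Φ X) :=
  Iff.rfl

/-- "The model Frobenioid associated to the divisor monoid `Φ^pf` and the rational function monoid
`ℚ · Ψ = Ψ^pf`" (Prop. 5.3 p. 103 for `Ψ = Φ^birat`: it is `(C^un-tr)^pf`; Prop. 5.5 (iv) p. 104: the
data `Φ^pf, B^pf, B^pf → (Φ^gp)^pf`). [cite: MochizukiFrdI2008, Prop. 5.3 p.103] -/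
abbrev PfModelOf : Type (max u w) := Ψ.perfection.ModelOf

end GpSubfunctor

end Perfection

/-! ### The realification `Φ^rlf` as a monoid on `D` (interface) and `ℝ · Ψ` -/

/-- INTERFACE (`TODO-merge: abc-iut-L1-t2`, ASSIGNMENTS I3): the *realification* `Φ^rlf` of a
perf-factorial monoid `Φ` on `D` regarded as a divisor monoid ON `D` (Prop. 5.3 p. 103: "the divisor
monoid `Φ^rlf` [i.e., the 'realification' of Definition 2.4, (i)]"), with the natural map
`Φ^pf → Φ^rlf` (Def. 2.4 (i)(c) p. 47: the factorization homomorphism places `M^pf ⊆ M^rlf`) and the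
`ℝ`-vector space structure of the groups `(Φ^rlf)^gp(X)` (Def. 2.4 (i) p. 48: "`(M^rlf)^gp ⊆
(M^rlf_factor)^gp = ∏_{𝔭 ∈ Prime(M)} (M^rlf_𝔭)^gp` is an `ℝ`-vector space"), compatible with the
pull-back maps. The objectwise `M^rlf` is `IsPerfFactorial.realification` (`PerfFactorial.lean`).
[cite: MochizukiFrdI2008, Prop. 5.3 p.103] -/
structure RealificationData (Φ : Dᵒᵖ ⥤ CommMonCat.{w}) where
  /-- `Φ^rlf : X ↦ Φ(X)^rlf` as a monoid on `D` -/
  rlf : Dᵒᵖ ⥤ CommMonCat.{w}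
  /-- the natural homomorphism `Φ^pf → Φ^rlf` (`M^pf ⊆ M^rlf`, Def. 2.4 (i)(c)) -/
  pfToRlf : perfectionFunctor Φ ⟶ rlf
  /-- scalar multiplication by `r ∈ ℝ` on the `ℝ`-vector space `(Φ^rlf)^gp(X)` (a group endomorphism) -/
  rsmul : ∀ X : D, ℝ →
    (Algebra.GrothendieckGroup (rlf.obj (op X)) →* Algebra.GrothendieckGroup (rlf.obj (op X)))
  /-- `(r + s) • x = r • x + s • x` -/
  rsmul_add : ∀ (X : D) (r s : ℝ) (x : Algebra.GrothendieckGroup (rlf.obj (op X))),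
    rsmul X (r + s) x = rsmul X r x * rsmul X s x
  /-- `(r s) • x = r • (s • x)` -/
  rsmul_mul : ∀ (X : D) (r s : ℝ) (x : Algebra.GrothendieckGroup (rlf.obj (op X))),
    rsmul X (r * s) x = rsmul X r (rsmul X s x)
  /-- `1 • x = x` -/
  rsmul_one : ∀ (X : D) (x : Algebra.GrothendieckGroup (rlf.obj (op X))), rsmul X 1 x = x
  /-- the pull-back maps `Φ^rlf(f)` are `ℝ`-linear -/
  pullGp_rsmul : ∀ {X Y : D} (f : X ⟶ Y) (r : ℝ) (x : Algebra.GrothendieckGroup (rlf.obj (op Y))),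
    pullGp rlf f (rsmul Y r x) = rsmul X r (pullGp rlf f x)

namespace RealificationData

variable {Φ : Dᵒᵖ ⥤ CommMonCat.{w}} (R : RealificationData Φ)

/-- The natural homomorphism `Φ → Φ^rlf` (composite `Φ → Φ^pf → Φ^rlf`).
[cite: MochizukiFrdI2008, Def. 2.4 (i) p.47] -/
def toRlf : Φ ⟶ R.rlf := toPerfectionFunctor Φ ≫ R.pfToRlf

/-- Its groupification `ι_X : Φ(X)^gp → (Φ^rlf(X))^gp`, through which `Φ^birat(X) ⊆ Φ(X)^gp` is viewed
inside `(Φ^rlf)^gp(X)` (Prop. 5.3 p. 103). [cite: MochizukiFrdI2008, Prop. 5.3 p.103] -/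
noncomputable def toRlfGp (X : D) :
    Algebra.GrothendieckGroup (Φ.obj (op X)) →* Algebra.GrothendieckGroup (R.rlf.obj (op X)) :=
  MonGp.map (R.toRlf.app (op X)).hom

/-- Naturality of `ι : Φ^gp → (Φ^rlf)^gp` with respect to pull-backs.
[cite: MochizukiFrdI2008, Prop. 5.3 p.103] -/
theorem toRlfGp_pullGp {X Y : D} (f : X ⟶ Y) (c : Algebra.GrothendieckGroup (Φ.obj (op Y))) :
    R.toRlfGp X (pullGp Φ f c) = pullGp R.rlf f (R.toRlfGp Y c) := by
  have key : (R.toRlfGp X).comp (pullGp Φ f) = (pullGp R.rlf f).comp (R.toRlfGp Y) := by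
    apply MonGp.hom_ext
    intro a
    have h := congrArg (fun g => (CommMonCat.Hom.hom g) a) (R.toRlf.naturality f.op)
    simp only [MonoidHom.comp_apply, toRlfGp, pullGp, MonGp.map_of]
    exact congrArg Algebra.GrothendieckGroup.of h
  exact DFunLike.congr_fun key c

variable (Ψ : GpSubfunctor Φ)

/-- The generators `r • ι(c)` (`r ∈ ℝ`, `c ∈ Ψ(X)`) of `ℝ · Ψ(X)`. [cite: MochizukiFrdI2008, Prop. 5.3 p.103] -/
def realSpanGen (X : D) : Set (Algebra.GrothendieckGroup (R.rlf.obj (op X))) :=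
  {x | ∃ (r : ℝ) (c : Algebra.GrothendieckGroup (Φ.obj (op X))),
      c ∈ Ψ.carrier X ∧ x = R.rsmul X r (R.toRlfGp X c)}

/-- `ℝ · Ψ ⊆ (Φ^rlf)^gp`: "for `A_D ∈ Ob(D)`, `(ℝ · Φ^birat)(A_D)` is the `ℝ`-vector subspace of
`(Φ^rlf)^gp(A_D)` generated by `Φ^birat(A_D)`" (Prop. 5.3 p. 103) — the subgroup generated by the
`r • ι(c)`, which is that subspace; a subfunctor of groups of `(Φ^rlf)^gp` since the pull-back maps
are `ℝ`-linear. [cite: MochizukiFrdI2008, Prop. 5.3 p.103] -/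
def realSpan : GpSubfunctor R.rlf where
  carrier X := Subgroup.closure (R.realSpanGen Ψ X)
  pull_mem := by
    intro X Y f c hc
    have hle : (Subgroup.closure (R.realSpanGen Ψ Y)).map (pullGp R.rlf f) ≤
        Subgroup.closure (R.realSpanGen Ψ X) := by
      rw [MonoidHom.map_closure]
      apply Subgroup.closure_mono
      rintro _ ⟨x, ⟨r, c, hc, rfl⟩, rfl⟩
      exact ⟨r, pullGp Φ f c, Ψ.pull_mem f hc, by rw [R.pullGp_rsmul, R.toRlfGp_pullGp]⟩
    exact hle (Subgroup.mem_map_of_mem _ hc)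

/-- "The model Frobenioid associated to the divisor monoid `Φ^rlf` and the rational function monoid
`ℝ · Ψ ⊆ (Φ^rlf)^gp`" (Prop. 5.3 p. 103; Prop. 5.5 (iv) p. 104: the data
`Φ^rlf, ℝ · Φ^birat, ℝ · Φ^birat ↪ (Φ^rlf)^gp`) — for `Ψ = Φ^birat` this is the **realification
`C^rlf`** of the Frobenioid `C`. [cite: MochizukiFrdI2008, Prop. 5.3 p.103] -/
abbrev RlfModelOf : Type (max u w) := (R.realSpan Ψ).ModelOf

end RealificationData

end Literature.AlgebraicGeometry.Frobenioids
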